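import Summits.QuantumFields.BalabanUV.Beta.GAN24.ContactOneGaugeCellMaxwell
import Summits.QuantumFields.BalabanUV.Beta.GAN24.ContactOneGaugeCellAlgebra
import Summits.QuantumFields.BalabanUV.Beta.GAN24.SymLinKernelFaceSupport

/-!
# `BalabanUV.Beta.GAN24.WilsonLetterFaceCharge` — binder row G-an2-4 ∕ (CONV-C), CT-W route «WC-TL» ∕ (Q-R) «QR-LL», the (S) row of RULING R-gan24p1-g27-1 B (viii),
# the Ward-type half (W-γ) located by p2 g39 (memo `W-GAMMA-ROUTE-v1.md`; WANTED W-2 «the (β)-style dψ pencil for (γ)∕(α⁺) in the EXIT sub-class»), PART 6: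
# **THE EXIT-FACE ⊗ EXIT-FACE CHARGE OF THE WILSON CUBIC LETTER IN CLOSED FORM — A MAXWELL OPERATOR OF AN EXPLICIT COARSE-COORDINATE 1-FORM, READ AT THE SLOT —
# AND ITS VANISHING IN EVERY SAME-DIRECTION CHANNEL** (p2's E26g «same-direction pairs ≡ 0; cross-direction u-dependent» as a theorem about the letter ALONE)
# (G-an2-4 formalisation swarm → CRUX TEAM (2), seat `b2b-balaban-gan24-formalise-leaf-02`, gen 55; pencil `g55/wgamma/WGAMMA-EXIT-PENCIL-v1.md` §1–§2)

NOT IN PRINT; OUR BOOKKEEPING ([folklore] composition BY NAME of this seat's gen-48∕50 Wilson-letter laws — `ContactOneGaugeCellAlgebra.tsum_dz_mul_wilsonA` (the FIRST-FLUCTUATION-LEG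
`dψ`-law of `StepJetData.wilsonA`, EVERY ψ), `ContactOneGaugeCellMaxwell.tsum_mul_curvAdj_curv_delta1` (the Maxwell contraction) — with PART 3a `SymLinKernelFaceSupport.exitFace_eq_dz_blk`
(the exit-face indicator is `dz` of the coarse coordinate) and an2's `AffineAveraging.curv_dz` (`dd = 0`); 0 `def`, 0 cited fact, 0 `def … : Prop`, 0 sorry).  HONEST FRAMING (cell
contract, verbatim): «discharging `BetaPertH` makes Bałaban's UV stability UNCONDITIONAL — a real constructive-QFT result; it is NOT the continuum limit and NOT the Clay problem.»
HONEST DEPENDENCY (verbatim): «continuum YM on T⁴ ⇐ BetaPertH ∧ nine spine estimates (0/9 proved); BetaPertH ⇐ (D1) ∧ (D4) ∧ CAP+tail; G-an2-4 gates asym, D1 and NE2/3/4.»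

WHAT (generic `d`, `ℤ^(d+1)`, `1 ≤ L`; `W = StepJetData.wilsonA d`, slot bond `(κ′, u)`, fluctuation legs `(a, x)`, `(b, z)`; `exit_c(z) = 𝟙[z_c % L = L−1]`, `ψ_c(z) = ⌊z_c∕L⌋`).
* §1 **`tsum_exitFace_mul_wilsonA`** — first leg against the exit face: `Σ'_x exit_a(x)·W κ′ u x z (inl a)(inl b) = ½(ψ_a(u+e_κ′) − ½(ψ_a z + ψ_a(z+e_b)))·(d*dδ_{(κ′,u)})_b(z)`.
* §2 **`tsum_exitFace_wilsonA_exitFace_eq_curvAdj`** — both legs: `Σ'_z exit_b(z)·Σ'_x exit_a(x)·W κ′ u x z (inl a)(inl b) = (d*d T^{u}_{ab})_{κ′}(u)`, `T^{u}_{ab} β z := dzψ_b β z·½(ψ_a(u+e_κ′) − ½(ψ_a z + ψ_a(z+e_β)))`,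
  and **`…_eq_neg_quarter_curvAdj`**: `= −¼·(d*d m_{ab})_{κ′}(u)` with the `u`-FREE 1-form **`m_{ab} β z := dzψ_b β z·(ψ_a z + ψ_a(z+e_β))`** (the slot term dies: `d(dψ_b) = 0`).
* §3 **`tsum_exitFace_wilsonA_exitFace_self`** — `a = b`: `m_{bb} = dz(ψ_b²)` (a ring identity), so the face charge is `0` at EVERY slot: p2 g39's E26g «same-direction ≡ 0».
READING for (W-γ): against ANY slot 1-form `r` the letter sum `Σ_ℓ r_ℓ·𝒵_{ab}(ℓ)` is `−¼⟨r, d*d m_{ab}⟩ = −¼⟨dr, d m_{ab}⟩ = −½⟨dr, dψ_a ∧ dψ_b⟩` (the resummation, pencil §3, self-checked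
EXACTLY on the table; typed separately) — so (W-γ) in the exit class is ONE curl identity of the defect read-vector over the block-EDGE plaquettes (E27 asked of p2).
Asserts NO value of any read vector; NOTHING of (W-γ) ∕ (INV) ∕ (S) ∕ (Q-R) ∕ (LT) claimed; NEVER «G-an2-4 closed» as (CONV-C); NOT D1, NOT `BetaPertH`, NOT continuum, NOT Clay.
2026-08-22; no existing file touched.
-/

noncomputable section

open Finset
open scoped BigOperators
open Literature.MathematicalPhysics.QuantumFieldTheory.Balaban1983to89
open Literature.MathematicalPhysics.QuantumFieldTheory.Balaban1983to89.Beta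
open StepJetData (wilsonA)
open AffineAveraging (Form1 dz curv curvAdj curv_dz)
open KKTFluctuationKernel (delta1)
open Summit.QuantumFields.BalabanUV.Beta.GAN24.ContactOneGaugeCellAlgebra (tsum_dz_mul_wilsonA affine_unitVec_eq)
open Summit.QuantumFields.BalabanUV.Beta.GAN24.ContactOneGaugeCellMaxwell (tsum_mul_curvAdj_curv_delta1)
open Summit.QuantumFields.BalabanUV.Beta.GAN24.SymLinKernelFaceSupport (exitFace_eq_dz_blk dz_blk_of_ne)

namespace Summit.QuantumFields.BalabanUV.Beta.GAN24.WilsonLetterFaceCharge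

variable {d : ℕ}

/-! ## §1 The first fluctuation leg against the exit face -/

/-- NOT IN PRINT; OUR BOOKKEEPING.  **THE WILSON CUBIC LETTER'S FIRST LEG AGAINST THE EXIT FACE** (`1 ≤ L`, every slot `(κ′,u)`, second leg `(b,z)`, channel `a`):
`Σ'_x 𝟙[x_a % L = L−1]·W κ′ u x z (inl a)(inl b) = ½(⌊(u+e_κ′)_a∕L⌋ − ½(⌊z_a∕L⌋ + ⌊(z+e_b)_a∕L⌋))·(d*dδ_{(κ′,u)})_b(z)` — the `dψ`-law `tsum_dz_mul_wilsonA` at the COARSE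
coordinate `ψ = ⌊·_a∕L⌋`, whose exterior derivative on the `a`-bonds is the exit-face indicator (`exitFace_eq_dz_blk`) and vanishes on the other bonds. -/
theorem tsum_exitFace_mul_wilsonA {L : ℕ} (hL : 1 ≤ L) (κ' : Fin (d + 1)) (u z : Fin (d + 1) → ℤ) (a b : Fin (d + 1)) :
    ∑' x, (if x a % (L : ℤ) = (L : ℤ) - 1 then (1 : ℝ) else 0) * wilsonA d κ' u x z (Sum.inl a) (Sum.inl b)
      = (1 / 2 : ℝ) * ((((u + B6BondElimination.unitVec κ') a / (L : ℤ) : ℤ) : ℝ)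
          - ((((z a / (L : ℤ) : ℤ) : ℝ)) + ((((z + B6BondElimination.unitVec b) a / (L : ℤ) : ℤ) : ℝ))) / 2)
        * curvAdj (curv (delta1 κ' u)) b z := by
  have h := tsum_dz_mul_wilsonA κ' u z b (fun w : Fin (d + 1) → ℤ => ((w a / (L : ℤ) : ℤ) : ℝ))
  have hpt : ∀ x : Fin (d + 1) → ℤ,
      ∑ α, dz (fun w : Fin (d + 1) → ℤ => ((w a / (L : ℤ) : ℤ) : ℝ)) α x * wilsonA d κ' u x z (Sum.inl α) (Sum.inl b)
        = (if x a % (L : ℤ) = (L : ℤ) - 1 then (1 : ℝ) else 0) * wilsonA d κ' u x z (Sum.inl a) (Sum.inl b) := by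
    intro x
    rw [Finset.sum_eq_single a]
    · rw [← exitFace_eq_dz_blk hL]
    · intro α _ hα
      rw [dz_blk_of_ne a hα, zero_mul]
    · exact fun h => absurd (Finset.mem_univ a) h
  simp only [hpt] at h
  rw [h]

/-! ## §2 Both legs: the face charge is a Maxwell operator read at the slot -/

/-- NOT IN PRINT; OUR BOOKKEEPING.  **THE EXIT ⊗ EXIT CHARGE OF THE WILSON CUBIC LETTER, ITERATED FORM**: with
`T β z := dzψ_b β z · ½(ψ_a(u+e_κ′) − ½(ψ_a z + ψ_a(z+e_β)))` (`ψ_c = ⌊·_c∕L⌋`),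
`Σ'_z 𝟙[z_b % L = L−1]·Σ'_x 𝟙[x_a % L = L−1]·W κ′ u x z (inl a)(inl b) = (d*d T)_{κ′}(u)` — §1 then the Maxwell contraction `tsum_mul_curvAdj_curv_delta1` (`dzψ_b` lives on the
`b`-bonds only, so the channel-`b` term IS the full `Σ_β`). -/
theorem tsum_exitFace_wilsonA_exitFace_eq_curvAdj {L : ℕ} (hL : 1 ≤ L) (κ' : Fin (d + 1)) (u : Fin (d + 1) → ℤ) (a b : Fin (d + 1)) :
    ∑' z, (if z b % (L : ℤ) = (L : ℤ) - 1 then (1 : ℝ) else 0) *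
        ∑' x, (if x a % (L : ℤ) = (L : ℤ) - 1 then (1 : ℝ) else 0) * wilsonA d κ' u x z (Sum.inl a) (Sum.inl b)
      = curvAdj (curv (fun β z => dz (fun w : Fin (d + 1) → ℤ => ((w b / (L : ℤ) : ℤ) : ℝ)) β z
          * ((1 / 2 : ℝ) * ((((u + B6BondElimination.unitVec κ') a / (L : ℤ) : ℤ) : ℝ)
            - ((((z a / (L : ℤ) : ℤ) : ℝ)) + ((((z + B6BondElimination.unitVec β) a / (L : ℤ) : ℤ) : ℝ))) / 2)))) κ' u := by
  rw [← tsum_mul_curvAdj_curv_delta1]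
  refine tsum_congr fun z => ?_
  rw [tsum_exitFace_mul_wilsonA hL, Finset.sum_eq_single b]
  · rw [← exitFace_eq_dz_blk hL]; ring
  · intro β _ hβ
    rw [dz_blk_of_ne b hβ, zero_mul, zero_mul]
  · exact fun h => absurd (Finset.mem_univ b) h

/-- [folklore] `curv` is additive-homogeneous: `curv (c•A − c′•B) = c•curv A − c′•curv B`. -/
theorem curv_smul_sub_smul (c c' : ℝ) (A B : Form1 (d + 1) ℝ) :
    curv (fun β z => c * A β z - c' * B β z) = fun κ l x => c * curv A κ l x - c' * curv B κ l x := by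
  funext κ l x
  simp only [AffineAveraging.curv]
  ring

/-- [folklore] `curvAdj` is additive-homogeneous. -/
theorem curvAdj_smul_sub_smul (c c' : ℝ) (F G : AffineAveraging.Form2 (d + 1) ℝ) :
    curvAdj (fun κ l x => c * F κ l x - c' * G κ l x) = fun μ y => c * curvAdj F μ y - c' * curvAdj G μ y := by
  funext μ y
  simp only [AffineAveraging.curvAdj]
  rw [mul_add, mul_add, Finset.mul_sum, Finset.mul_sum, Finset.mul_sum, Finset.mul_sum, add_sub_add_comm, ← Finset.sum_sub_distrib, ← Finset.sum_sub_distrib]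
  congr 1 <;> exact Finset.sum_congr rfl fun i _ => by ring

/-- [folklore] `d*d` is linear: `d*d(c•A − c′•B) = c•d*dA − c′•d*dB`. -/
theorem curvAdj_curv_sub_smul (c c' : ℝ) (A B : Form1 (d + 1) ℝ) (κ' : Fin (d + 1)) (u : Fin (d + 1) → ℤ) :
    curvAdj (curv (fun β z => c * A β z - c' * B β z)) κ' u = c * curvAdj (curv A) κ' u - c' * curvAdj (curv B) κ' u := by
  rw [curv_smul_sub_smul, curvAdj_smul_sub_smul]

/-- NOT IN PRINT; OUR BOOKKEEPING.  **THE `u`-FREE CLOSED FORM**: `Σ'_z exit_b(z)·Σ'_x exit_a(x)·W κ′ u x z (inl a)(inl b) = −¼·(d*d m_{ab})_{κ′}(u)` with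
**`m_{ab} β z := dzψ_b β z·(ψ_a z + ψ_a(z+e_β))`** — the slot term `½ψ_a(u+e_κ′)•dzψ_b` of §2's `T` is killed by `d(dzψ_b) = 0` (an2's `curv_dz`). -/
theorem tsum_exitFace_wilsonA_exitFace_eq_neg_quarter_curvAdj {L : ℕ} (hL : 1 ≤ L) (κ' : Fin (d + 1)) (u : Fin (d + 1) → ℤ) (a b : Fin (d + 1)) :
    ∑' z, (if z b % (L : ℤ) = (L : ℤ) - 1 then (1 : ℝ) else 0) *
        ∑' x, (if x a % (L : ℤ) = (L : ℤ) - 1 then (1 : ℝ) else 0) * wilsonA d κ' u x z (Sum.inl a) (Sum.inl b)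
      = -(1 / 4 : ℝ) * curvAdj (curv (fun β z => dz (fun w : Fin (d + 1) → ℤ => ((w b / (L : ℤ) : ℤ) : ℝ)) β z
          * ((((z a / (L : ℤ) : ℤ) : ℝ)) + (((z + B6BondElimination.unitVec β) a / (L : ℤ) : ℤ) : ℝ)))) κ' u := by
  rw [tsum_exitFace_wilsonA_exitFace_eq_curvAdj hL]
  set cu : ℝ := ((((u + B6BondElimination.unitVec κ') a / (L : ℤ) : ℤ) : ℝ)) with hcu
  have e : (fun β z => dz (fun w : Fin (d + 1) → ℤ => ((w b / (L : ℤ) : ℤ) : ℝ)) β z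
        * ((1 / 2 : ℝ) * (cu - ((((z a / (L : ℤ) : ℤ) : ℝ)) + (((z + B6BondElimination.unitVec β) a / (L : ℤ) : ℤ) : ℝ)) / 2)))
      = fun β z => (cu / 2) * dz (fun w : Fin (d + 1) → ℤ => ((w b / (L : ℤ) : ℤ) : ℝ)) β z
        - (1 / 4 : ℝ) * (dz (fun w : Fin (d + 1) → ℤ => ((w b / (L : ℤ) : ℤ) : ℝ)) β z
          * ((((z a / (L : ℤ) : ℤ) : ℝ)) + (((z + B6BondElimination.unitVec β) a / (L : ℤ) : ℤ) : ℝ))) := by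
    funext β z; ring
  rw [e, curvAdj_curv_sub_smul]
  have h0 : curvAdj (curv (dz (fun w : Fin (d + 1) → ℤ => ((w b / (L : ℤ) : ℤ) : ℝ)))) κ' u = 0 := by
    have hc : curv (dz (fun w : Fin (d + 1) → ℤ => ((w b / (L : ℤ) : ℤ) : ℝ))) = 0 := by
      have := curv_dz (fun w : Fin (d + 1) → ℤ => ((w b / (L : ℤ) : ℤ) : ℝ))
      simpa only [affine_unitVec_eq] using this
    rw [hc]
    simp [AffineAveraging.curvAdj]
  rw [h0]
  ring

/-! ## §3 Same-direction channels vanish per letter -/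

/-- NOT IN PRINT; OUR BOOKKEEPING.  **IN EVERY SAME-DIRECTION CHANNEL THE WILSON LETTER'S EXIT ⊗ EXIT CHARGE IS ZERO AT EVERY SLOT** (p2 g39's E26g «same-direction pairs ≡ 0»):
`m_{bb} β z = dzψ_b β z·(ψ_b z + ψ_b(z+e_β)) = ψ_b(z+e_β)² − ψ_b(z)² = dz(ψ_b²) β z` is EXACT, so `d m_{bb} = 0` and §2's `−¼·d*d m_{bb}` vanishes. -/
theorem tsum_exitFace_wilsonA_exitFace_self {L : ℕ} (hL : 1 ≤ L) (κ' : Fin (d + 1)) (u : Fin (d + 1) → ℤ) (b : Fin (d + 1)) :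
    ∑' z, (if z b % (L : ℤ) = (L : ℤ) - 1 then (1 : ℝ) else 0) *
        ∑' x, (if x b % (L : ℤ) = (L : ℤ) - 1 then (1 : ℝ) else 0) * wilsonA d κ' u x z (Sum.inl b) (Sum.inl b) = 0 := by
  rw [tsum_exitFace_wilsonA_exitFace_eq_neg_quarter_curvAdj hL]
  have e : (fun β z => dz (fun w : Fin (d + 1) → ℤ => ((w b / (L : ℤ) : ℤ) : ℝ)) β z
        * ((((z b / (L : ℤ) : ℤ) : ℝ)) + (((z + B6BondElimination.unitVec β) b / (L : ℤ) : ℤ) : ℝ)))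
      = dz (fun w : Fin (d + 1) → ℤ => (((w b / (L : ℤ) : ℤ) : ℝ)) ^ 2) := by
    funext β z
    simp only [AffineAveraging.dz, affine_unitVec_eq]
    ring
  rw [e]
  have hc : curv (dz (fun w : Fin (d + 1) → ℤ => (((w b / (L : ℤ) : ℤ) : ℝ)) ^ 2)) = 0 := by
    have := curv_dz (fun w : Fin (d + 1) → ℤ => (((w b / (L : ℤ) : ℤ) : ℝ)) ^ 2)
    simpa only [affine_unitVec_eq] using this
  rw [hc]
  simp [AffineAveraging.curvAdj]

end Summit.QuantumFields.BalabanUV.Beta.GAN24.WilsonLetterFaceCharge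

end
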